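import Literature.Computability.ImplicitComplexity.STAWeighted
import HarnessLib

/-!
# Merging renamed-apart copies of a box by multiplexors

Support file for the `PTIME` soundness half of `STACapturesP` (GMR08 Thm. 3.5). In the
multiplexor case of GR07's substitution lemma (GMR08 Lemma 3.4), the variable `x : !σ` contracted
from `x₁, …, xₙ : σ` (`n ≤ r`) receives a box `N : !σ`; one substitutes `n` copies of the
content `Γ' ⊢ N : σ` of the box, their free variables renamed apart, for `x₁, …, xₙ`, and then
CONTRACTS, for every variable `y` of `Γ'`, its `n` copies back into `y : !(Γ' y)` by one
multiplexor of rank `n` — so ranks stay `≤ r` and the weight is unchanged. This file proves that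
last step in de Bruijn form, with the copies laid out in blocks: copy `x ∈ S` of slot `y < m`
lives at slot `m·(x+1) + y`.

* `STA.IsCopy m S Γ' i'` — slot `i'` is the copy, in some block `x ∈ S`, of a slot of `Γ'`;
* `STA.mergeRen m S Γ'` — the renaming sending every copy to its original slot;
* `STA.mergedCtx m S Γ' Φ₀` — the context after merging: `y : !(Γ' y)` on the support of
  `Γ'`, the copy slots emptied, the rest of `Φ₀` unchanged;
* `MTyping.mergeCopies` — from `Φ₀ ⊢ M : μ`, where `Φ₀` carries `Γ' y` at every copy slot
  `m·(x+1)+y` and nothing at the target slots `y`, derive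
  `mergedCtx m S Γ' Φ₀ ⊢ M[mergeRen m S Γ'] : μ` with the same rank bound (`|S| ≤ r`), degree and
  weight.

## References

* [GaboardiMarionRonchidellarocca2008] GMR08, Table 2 (rule `(m)`), §3.1 (Lemma 3.4),
  Def. A.1 (`(m)` does not change the weight).
* [GaboardiRonchiDellaRocca2007] GR07, §4 (Substitution Lemma, case `(m)`).
-/

namespace Literature.Computability.ImplicitComplexity

namespace STA

/-! ### Block layout of the copies -/

/-- Slot `i'` is a copy slot: it lies in block `x = i'/m - 1 ∈ S` (blocks start at `m`) and its
offset `i' % m` is a slot of `Γ'`. [folklore] -/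
def IsCopy (m : ℕ) (S : Finset ℕ) (Γ' : Ctx) (i' : ℕ) : Prop :=
  m ≤ i' ∧ (i' / m - 1) ∈ S ∧ (Γ' (i' % m)).isSome = true

/-- `IsCopy` is decidable (a conjunction of decidable conditions). [folklore] -/
instance IsCopy.instDecidable (m : ℕ) (S : Finset ℕ) (Γ' : Ctx) (i' : ℕ) :
    Decidable (IsCopy m S Γ' i') :=
  inferInstanceAs (Decidable (_ ∧ _ ∧ _))

/-- The merging renaming: every copy slot goes to its original slot. [folklore] -/
def mergeRen (m : ℕ) (S : Finset ℕ) (Γ' : Ctx) (i' : ℕ) : ℕ :=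
  if IsCopy m S Γ' i' then i' % m else i'

/-- The context after merging all copies: the slots of `Γ'` promoted, the copy slots emptied.
[folklore] -/
def mergedCtx (m : ℕ) (S : Finset ℕ) (Γ' : Ctx) (Φ₀ : Ctx) : Ctx := fun i' =>
  if (Γ' i').isSome = true then (Γ' i').map SoftTy.bang
  else if IsCopy m S Γ' i' then none else Φ₀ i'

/-- The renaming after merging the copies of the slots `< t`. [folklore] -/
def mergeRenT (m : ℕ) (S : Finset ℕ) (Γ' : Ctx) (t : ℕ) (i' : ℕ) : ℕ :=
  if IsCopy m S Γ' i' ∧ i' % m < t then i' % m else i'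

/-- The context after merging the copies of the slots `< t`. [folklore] -/
def mergedCtxT (m : ℕ) (S : Finset ℕ) (Γ' : Ctx) (Φ₀ : Ctx) (t : ℕ) : Ctx := fun i' =>
  if (Γ' i').isSome = true ∧ i' < t then (Γ' i').map SoftTy.bang
  else if IsCopy m S Γ' i' ∧ i' % m < t then none else Φ₀ i'

section layout

variable {m : ℕ}

/-- The copy of slot `y < m` in block `x` lies in block `x`. [folklore] -/
theorem copy_div (hm : 0 < m) {x y : ℕ} (hy : y < m) : (m * (x + 1) + y) / m = x + 1 := by
  rw [Nat.mul_add_div hm, Nat.div_eq_of_lt hy, Nat.add_zero]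

/-- The copy of slot `y < m` in block `x` has offset `y`. [folklore] -/
theorem copy_mod {x y : ℕ} (hy : y < m) : (m * (x + 1) + y) % m = y := by
  rw [Nat.mul_add_mod, Nat.mod_eq_of_lt hy]

/-- A copy slot is the copy, in its block, of its offset. [folklore] -/
theorem eq_copy_of_le (hm : 0 < m) {i' : ℕ} (hi' : m ≤ i') :
    i' = m * ((i' / m - 1) + 1) + i' % m := by
  have hpos : 0 < i' / m := Nat.div_pos hi' hm
  rw [Nat.sub_add_cancel hpos]
  exact (Nat.div_add_mod i' m).symm

end layout

/-! ### The merging lemma -/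

namespace MTyping

variable {r d w : ℕ} {M : Term} {μ : SoftTy}

/-- **Merging the copies of a box** (GR07 substitution lemma, case `(m)`): if `Φ₀ ⊢ M : μ` where,
for a finite context `Γ'` supported below `m` and a set `S` of blocks with `|S| ≤ r`, every copy
slot `m·(x+1)+y` (`x ∈ S`, `y ∈ supp Γ'`) carries `Γ' y` and every target slot `y ∈ supp Γ'` is
empty, then `|supp Γ'|` multiplexors of rank `|S|` give
`mergedCtx m S Γ' Φ₀ ⊢ M[mergeRen m S Γ'] : μ` — the targets now carry `!(Γ' y)`, the copies are
gone — with the same rank bound, degree and weight.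
[cite: GaboardiMarionRonchidellarocca2008, Table 2 (m) and Def. A.1] -/
theorem mergeCopies {m : ℕ} (hm : 0 < m) {S : Finset ℕ} (hr : S.card ≤ r) {Γ' Φ₀ : Ctx}
    (hΓ'm : ∀ y, Γ' y ≠ none → y < m)
    (hcopy : ∀ x ∈ S, ∀ y, Γ' y ≠ none → Φ₀ (m * (x + 1) + y) = Γ' y)
    (htarget : ∀ y, Γ' y ≠ none → Φ₀ y = none)
    (h : MTyping r w d Φ₀ M μ) :
    MTyping r w d (mergedCtx m S Γ' Φ₀) (M.rename (mergeRen m S Γ')) μ := by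
  -- merge the targets one at a time
  have key : ∀ t, MTyping r w d (mergedCtxT m S Γ' Φ₀ t) (M.rename (mergeRenT m S Γ' t)) μ := by
    intro t
    induction t with
    | zero =>
      have hc : mergedCtxT m S Γ' Φ₀ 0 = Φ₀ := by
        funext i'; simp [mergedCtxT]
      have hρ : M.rename (mergeRenT m S Γ' 0) = M := by
        rw [Term.rename_congr (ρ₂ := fun i => i) (fun i => by simp [mergeRenT]) M]
        exact Term.rename_id' M
      rw [hc, hρ]
      exact h
    | succ t ih =>
      cases hΓt : Γ' t with
      | none =>
        -- nothing to merge at `t`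
        have hc : mergedCtxT m S Γ' Φ₀ (t + 1) = mergedCtxT m S Γ' Φ₀ t := by
          funext i'
          simp only [mergedCtxT]
          by_cases h1 : i' = t
          · subst h1
            by_cases hc : IsCopy m S Γ' i'
            · have hlt : i' % m < i' := lt_of_lt_of_le (Nat.mod_lt _ hm) hc.1
              have hle : i' % m ≤ i' := hlt.le
              simp [hΓt, hc, hlt, hle]
            · simp [hΓt, hc]
          · have e1 : (i' < t + 1) ↔ (i' < t) := by omega
            by_cases h2 : i' % m = t
            · have hnc : ¬IsCopy m S Γ' i' := by
                rintro ⟨-, -, hs⟩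
                rw [h2, hΓt] at hs
                exact Bool.false_ne_true hs
              simp [e1, hnc]
            · have e2 : (i' % m < t + 1) ↔ (i' % m < t) := by omega
              simp only [e1, e2]
        have hρ : ∀ i', mergeRenT m S Γ' (t + 1) i' = mergeRenT m S Γ' t i' := by
          intro i'
          simp only [mergeRenT]
          by_cases h2 : i' % m = t
          · have hnc : ¬IsCopy m S Γ' i' := by
              rintro ⟨-, -, hs⟩
              rw [h2, hΓt] at hs
              exact Bool.false_ne_true hs
            simp [hnc]
          · have e2 : (i' % m < t + 1) ↔ (i' % m < t) := by omega
            simp only [e2]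
        rw [hc, Term.rename_congr hρ M]
        exact ih
      | some τ =>
        have htm : t < m := hΓ'm t (by rw [hΓt]; simp)
        -- the copies of `t`
        have hinj : Function.Injective fun x : ℕ => m * (x + 1) + t := by
          intro a b hab
          have : m * (a + 1) = m * (b + 1) := by simpa using hab
          have := Nat.eq_of_mul_eq_mul_left hm this
          omega
        have hmemSt : ∀ i', i' ∈ S.image (fun x => m * (x + 1) + t) ↔
            IsCopy m S Γ' i' ∧ i' % m = t := by
          intro i'
          constructor
          · intro hi'
            obtain ⟨x, hx, rfl⟩ := Finset.mem_image.1 hi'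
            refine ⟨⟨?_, ?_, ?_⟩, copy_mod htm⟩
            · have : m * 1 ≤ m * (x + 1) := Nat.mul_le_mul_left _ (by omega)
              omega
            · rw [copy_div hm htm, Nat.add_sub_cancel]; exact hx
            · rw [copy_mod htm, hΓt]; rfl
          · rintro ⟨⟨hmi, hx, -⟩, hmod⟩
            refine Finset.mem_image.2 ⟨i' / m - 1, hx, ?_⟩
            have := eq_copy_of_le hm hmi
            rw [hmod] at this
            exact this.symm
        refine MTyping.mpx (σ := τ) (S.image fun x => m * (x + 1) + t) t ih ?_ ?_ ?_ ?_ ?_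
        · -- the copies of `t` carry `τ`
          intro i' hi'
          obtain ⟨hc, hmod⟩ := (hmemSt i').1 hi'
          obtain ⟨x, hx, rfl⟩ := Finset.mem_image.1 hi'
          have hΓi : (Γ' (m * (x + 1) + t)).isSome = false := by
            cases hΓ : Γ' (m * (x + 1) + t) with
            | none => rfl
            | some σ =>
              have := hΓ'm _ (by rw [hΓ]; simp)
              have h1 : m * 1 ≤ m * (x + 1) := Nat.mul_le_mul_left _ (by omega)
              omega
          simp only [mergedCtxT, hΓi, Bool.false_eq_true, false_and, if_false, hmod,
            lt_irrefl, and_false]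
          rw [hcopy x hx t (by rw [hΓt]; simp), hΓt]
        · -- the target `t` is empty
          have hnc : ¬IsCopy m S Γ' t := fun ⟨hmt, _, _⟩ => absurd htm (by omega)
          simp only [mergedCtxT, lt_irrefl, and_false, if_false, hnc, false_and]
          exact htarget t (by rw [hΓt]; simp)
        · rw [Finset.card_image_of_injective _ hinj]; exact hr
        · -- the resulting context
          funext i'
          by_cases hSt : i' ∈ S.image (fun x => m * (x + 1) + t)
          · obtain ⟨hc, hmod⟩ := (hmemSt i').1 hSt
            have hΓi : (Γ' i').isSome = false := by
              cases hΓ : Γ' i' with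
              | none => rfl
              | some σ =>
                have := hΓ'm _ (by rw [hΓ]; simp)
                exact absurd hc.1 (by omega)
            have hlt : i' % m < t + 1 := by omega
            simp [mergedCtxT, Ctx.mpx, hSt, hΓi, hc, hlt]
          · by_cases hit : i' = t
            · subst hit
              simp [mergedCtxT, Ctx.mpx, hSt, hΓt]
            · have e1 : (i' < t + 1) ↔ (i' < t) := by omega
              have e2 : IsCopy m S Γ' i' → ((i' % m < t + 1) ↔ (i' % m < t)) := by
                intro hc
                have hne : i' % m ≠ t := fun he => hSt ((hmemSt i').2 ⟨hc, he⟩)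
                omega
              simp only [mergedCtxT, Ctx.mpx, hSt, if_false, hit, e1]
              by_cases hc : IsCopy m S Γ' i'
              · simp only [hc, true_and, e2 hc]
              · simp only [hc, false_and, if_false]
        · -- the resulting renaming
          rw [Term.rename_rename]
          refine Term.rename_congr (fun i' => ?_) M
          simp only [Function.comp_apply, mergeRenT, mpxRen]
          by_cases hc : IsCopy m S Γ' i'
          · have hylt : i' % m < m := Nat.mod_lt _ hm
            by_cases hlt : i' % m < t
            · have hlt' : i' % m < t + 1 := by omega
              have hnot : i' % m ∉ S.image (fun x => m * (x + 1) + t) := by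
                intro hmem
                have := ((hmemSt _).1 hmem).1.1
                omega
              simp [hc, hlt, hlt', hnot]
            · by_cases heq : i' % m = t
              · have hmem : i' ∈ S.image (fun x => m * (x + 1) + t) := (hmemSt i').2 ⟨hc, heq⟩
                have hlt' : i' % m < t + 1 := by omega
                simp [hc, hmem, heq]
              · have hnmem : i' ∉ S.image (fun x => m * (x + 1) + t) :=
                  fun hmem => heq ((hmemSt i').1 hmem).2
                have hlt' : ¬(i' % m < t + 1) := by omega
                simp [hc, hlt, hlt', hnmem]
          · have hnmem : i' ∉ S.image (fun x => m * (x + 1) + t) :=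
              fun hmem => hc ((hmemSt i').1 hmem).1
            simp [hc, hnmem]
  -- at `t = m` everything is merged
  have hc : mergedCtxT m S Γ' Φ₀ m = mergedCtx m S Γ' Φ₀ := by
    funext i'
    simp only [mergedCtxT, mergedCtx]
    by_cases hs : (Γ' i').isSome = true
    · have := hΓ'm i' (Option.isSome_iff_ne_none.1 hs)
      simp [hs, this]
    · by_cases hcp : IsCopy m S Γ' i'
      · simp [hs, hcp, Nat.mod_lt _ hm]
      · simp [hs, hcp]
  have hρ : ∀ i', mergeRenT m S Γ' m i' = mergeRen m S Γ' i' := by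
    intro i'
    simp only [mergeRenT, mergeRen]
    by_cases hcp : IsCopy m S Γ' i'
    · simp [hcp, Nat.mod_lt _ hm]
    · simp [hcp]
  rw [← hc, ← Term.rename_congr hρ M]
  exact key m

end MTyping

end STA

end Literature.Computability.ImplicitComplexity
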